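import Summits.ResolutionOfSingularities.ResolutionOfSingularities.Theorems.FrobeniusLadderFInjectiveMacaulayficationClauseOfPderivNotMem
import Summits.ResolutionOfSingularities.ResolutionOfSingularities.Theorems.FrobeniusLadderFInjectiveMacaulayficationFedderAlongCoordinateLine
import Summits.ResolutionOfSingularities.ResolutionOfSingularities.Theorems.FrobeniusLadderFInjectiveMacaulayficationE8Forms
import Mathlib.Algebra.MvPolynomial.PDeriv
import Mathlib.Algebra.Polynomial.RingDivision
import Mathlib.RingTheory.PrincipalIdealDomain
import Mathlib.RingTheory.Coprime.Lemmas
import Mathlib.RingTheory.MvPolynomial.Basic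
import Mathlib.Tactic.LinearCombination
import HarnessLib

/-!
# The specimen threefold `f₄ = X₂² + X₀³ + X₁⁶ + X₃³X₀²` in characteristic `5`: integral, one bad point

Support file for crux stmt-ResolutionOfSingularities-15315
(`FrobeniusLadder.FInjectiveMacaulayfication`, line `Sketch`, lead seat c8): stub `stub_f4Isolated`
of the §15 calibration (weighted cone engine, specimen `f₄`).

Let `k` be a field of characteristic `5`, `S = k[X₀, X₁, X₂, X₃]` and
`f = X₂² + X₀³ + X₁⁶ + X₃³X₀²`. What is proved:

* `prime_f4` — `f` is prime over ANY field: under `S ≃ k[X₀,X₁,X₂][T]`, `X₂ ↦ T`, `f ↦ T² + c` with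
  `-c` a non-square (setting two variables to `0` evaluates `c` to `-T³`, odd degree), so the
  `E8Forms` template `prime_and_not_dvd_of_ringEquiv` applies.
* `pderiv_zero_f4`, …, `pderiv_three_f4` — the partial derivatives over any commutative ring:
  `∂₀f = 3X₀² + 2X₃³X₀`, `∂₁f = 6X₁⁵`, `∂₂f = 2X₂`, `∂₃f = 3X₃²X₀²`.
* `f4_pow_four_sub_mem` — in any commutative ring, `f⁴ - 6·x₀⁴x₂⁴x₃⁶` lies in every ideal containing
  `x₀⁵, x₁⁵, x₂⁵` (the only product of four summands of `f` with `X₀`-, `X₁`-, `X₂`-exponents `< 5`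
  is `X₂²·X₂²·X₃³X₀²·X₃³X₀²`, multinomial coefficient `6`; proved by three small `ring` identities).
* `monomial_notMem_span_pow` — the Fedder witness off the origin: for a non-unit `c ∈ k[T]` NOT
  divisible by `T`, `X₀⁴X₂⁴X₃⁶ ∉ (X₀⁵, X₁⁵, X₂⁵, c(X₃)⁵)` (apply the `X₀⁴X₂⁴`-extraction
  `E : S →+ k[T]` of `FedderAlongCoordinateLine`: it maps the ideal into `(c⁵)` and the monomial to
  `T⁶`, and `c ∣ T⁶` with `c` coprime to `T` forces `c` to be a unit).
* `stub_f4Isolated` — the registered form: `(f)` is prime, and at every maximal ideal `Q` of `S/(f)`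
  missing some `x̄ⱼ` the local ring `(S/(f))_Q` satisfies the per-stalk clause of the crux. If some
  `∂ⱼf ∉ P = Q ∩ S`: Jacobian (`ClauseOfPderivNotMem.stub_clauseOfPderivNotMem`). Otherwise
  `X₀, X₁, X₂ ∈ P`, hence `X₃ ∉ P`; `P = (X₀, X₁, X₂, c(X₃))` for a non-unit `c`
  (`FedderAlongCoordinateLine.exists_eq_span_of_X_mem`) with `T ∤ c` (else `P = (X) ∋ X₃`); as `6`
  is a unit, `f⁴ ∉ (X₀⁵, X₁⁵, X₂⁵, c(X₃)⁵)`, and Fedder's test at `P`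
  (`FedderAtMaximalIdeal.stub_fedderAtMaximalIdeal`) gives the clause. At the origin itself the test
  fails (`f⁴ ∈ 𝔪^[5]`) — the hypothesis `∃ j, x̄ⱼ ∉ Q` is used exactly to exclude it.

References: [Fedder1983] R. Fedder, F-purity and rational singularity, Trans. AMS 278 (1983),
Prop. 1.7 and Thm. 1.12 (through the imported test); [Matsumura1987] H. Matsumura, *Commutative Ring
Theory*, Thm. 30.4 (through the imported Jacobian discharger). The computation itself is folklore.
-/

-- single-problem summit: the doubled namespace component is forced
set_option linter.dupNamespace false

noncomputable section

namespace Summit.ResolutionOfSingularities.ResolutionOfSingularities.Theorems.FInjectiveMacaulayfication.F4Isolated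

open MvPolynomial
open Summit.ResolutionOfSingularities.ResolutionOfSingularities.Theorems.FInjectiveMacaulayfication

/-! ## Primality of `f₄` over any field -/

/-- **Odd-degree test for non-squares** (any number of variables): if an evaluation
`k[Xᵢ : i ∈ σ] → k[T]` sends `c` to `-T^(2n+1)`, then `-c` is not a square (a square root would
evaluate to `b` with `b² = T^(2n+1)` of odd degree `2 deg b`). [folklore] -/
-- adapted from `E8Forms.mul_self_ne_neg_of_aeval` (the case `σ = Fin 2`)
theorem mul_self_ne_neg_of_aeval {k : Type} [Field k] {σ : Type} {c : MvPolynomial σ k}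
    (v : σ → Polynomial k) (n : ℕ)
    (hv : MvPolynomial.aeval v c = -(Polynomial.X ^ (2 * n + 1) : Polynomial k))
    (a : MvPolynomial σ k) : a * a ≠ -c := by
  intro h
  have h2 : MvPolynomial.aeval v a * MvPolynomial.aeval v a =
      (Polynomial.X ^ (2 * n + 1) : Polynomial k) := by
    rw [← map_mul, h, map_neg, hv, neg_neg]
  have hX : (Polynomial.X ^ (2 * n + 1) : Polynomial k) ≠ 0 := pow_ne_zero _ Polynomial.X_ne_zero
  have ha : MvPolynomial.aeval v a ≠ 0 := by
    intro h0
    rw [h0, zero_mul] at h2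
    exact hX h2.symm
  have h3 := congrArg Polynomial.natDegree h2
  rw [Polynomial.natDegree_mul ha ha, Polynomial.natDegree_X_pow] at h3
  omega

/-- **`f₄ = X₂² + X₀³ + X₁⁶ + X₃³X₀²` is prime over every field.** Identify `k[X₀, …, X₃]` with
`k[Y₀,Y₁,Y₂][T]` by `X₂ ↦ T`, `X₀ ↦ Y₁`, `X₁ ↦ Y₀`, `X₃ ↦ Y₂` (`renameEquiv (swap 0 2)` then
`finSuccEquiv`); `f ↦ T² + c`, `c = Y₁³ + Y₀⁶ + Y₂³Y₁²`, and `-c` is not a square (`Y₀, Y₂ ↦ 0`,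
`Y₁ ↦ -T` evaluates `c` to `-T³`), so `E8Forms.prime_and_not_dvd_of_ringEquiv` applies. [folklore] -/
theorem prime_f4 (k : Type) [Field k] (f : MvPolynomial (Fin 4) k)
    (hf : f = X 2 ^ 2 + X 0 ^ 3 + X 1 ^ 6 + X 3 ^ 3 * X 0 ^ 2) : Prime f := by
  -- the identification `k[X₀,…,X₃] ≃ k[Y₀,Y₁,Y₂][T]`
  obtain ⟨e, he0, he1, he2, he3⟩ : ∃ e : MvPolynomial (Fin 4) k ≃+* Polynomial (MvPolynomial (Fin 3) k),
      e (X 0) = Polynomial.C (X 1) ∧ e (X 1) = Polynomial.C (X 0) ∧ e (X 2) = Polynomial.X ∧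
        e (X 3) = Polynomial.C (X 2) := by
    refine ⟨((MvPolynomial.renameEquiv k (Equiv.swap (0 : Fin 4) 2)).trans
      (MvPolynomial.finSuccEquiv k 3)).toRingEquiv, ?_, ?_, ?_, ?_⟩
    · show MvPolynomial.finSuccEquiv k 3
          (MvPolynomial.rename (Equiv.swap (0 : Fin 4) 2) (X 0)) = _
      rw [MvPolynomial.rename_X, Equiv.swap_apply_left]
      exact MvPolynomial.finSuccEquiv_X_succ (j := 1)
    · show MvPolynomial.finSuccEquiv k 3
          (MvPolynomial.rename (Equiv.swap (0 : Fin 4) 2) (X 1)) = _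
      rw [MvPolynomial.rename_X, Equiv.swap_apply_of_ne_of_ne (by decide) (by decide)]
      exact MvPolynomial.finSuccEquiv_X_succ (j := 0)
    · show MvPolynomial.finSuccEquiv k 3
          (MvPolynomial.rename (Equiv.swap (0 : Fin 4) 2) (X 2)) = _
      rw [MvPolynomial.rename_X, Equiv.swap_apply_right]
      exact MvPolynomial.finSuccEquiv_X_zero
    · show MvPolynomial.finSuccEquiv k 3
          (MvPolynomial.rename (Equiv.swap (0 : Fin 4) 2) (X 3)) = _
      rw [MvPolynomial.rename_X, Equiv.swap_apply_of_ne_of_ne (by decide) (by decide)]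
      exact MvPolynomial.finSuccEquiv_X_succ (j := 2)
  have hef : e f = Polynomial.X ^ 2 +
      Polynomial.C (X 1 ^ 3 + X 0 ^ 6 + X 2 ^ 3 * X 1 ^ 2 : MvPolynomial (Fin 3) k) := by
    subst hf
    simp only [map_add, map_mul, map_pow, he0, he1, he2, he3]
    ring
  have hc : ∀ a : MvPolynomial (Fin 3) k, a * a ≠ -(X 1 ^ 3 + X 0 ^ 6 + X 2 ^ 3 * X 1 ^ 2) :=
    mul_self_ne_neg_of_aeval (fun i : Fin 3 => if i = 1 then -Polynomial.X else 0) 1 (by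
      simp only [map_add, map_mul, map_pow, MvPolynomial.aeval_X, Fin.isValue, Fin.reduceEq,
        if_true, if_false]
      ring)
  exact (E8Forms.prime_and_not_dvd_of_ringEquiv e f _ hef hc).1

/-! ## The partial derivatives -/

/-- **`∂f₄/∂X₀ = 3X₀² + 2X₃³X₀`** over any commutative ring (`pderiv_mul`, `pderiv_pow`,
`pderiv_X_self`, `pderiv_X_of_ne`). [folklore] -/
theorem pderiv_zero_f4 {A : Type*} [CommRing A] :
    pderiv 0 (X 2 ^ 2 + X 0 ^ 3 + X 1 ^ 6 + X 3 ^ 3 * X 0 ^ 2 : MvPolynomial (Fin 4) A) =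
      3 * X 0 ^ 2 + 2 * (X 3 ^ 3 * X 0) := by
  simp only [map_add, pderiv_mul, pderiv_pow, pderiv_X_self,
    pderiv_X_of_ne (show (1 : Fin 4) ≠ 0 by decide), pderiv_X_of_ne (show (2 : Fin 4) ≠ 0 by decide),
    pderiv_X_of_ne (show (3 : Fin 4) ≠ 0 by decide), Nat.reduceSub, pow_one, mul_one, mul_zero,
    zero_mul, add_zero, zero_add, Nat.cast_ofNat]
  ring

/-- **`∂f₄/∂X₁ = 6X₁⁵`** over any commutative ring (`pderiv_mul`, `pderiv_pow`, `pderiv_X_self`,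
`pderiv_X_of_ne`). [folklore] -/
theorem pderiv_one_f4 {A : Type*} [CommRing A] :
    pderiv 1 (X 2 ^ 2 + X 0 ^ 3 + X 1 ^ 6 + X 3 ^ 3 * X 0 ^ 2 : MvPolynomial (Fin 4) A) =
      6 * X 1 ^ 5 := by
  simp only [map_add, pderiv_mul, pderiv_pow, pderiv_X_self,
    pderiv_X_of_ne (show (0 : Fin 4) ≠ 1 by decide), pderiv_X_of_ne (show (2 : Fin 4) ≠ 1 by decide),
    pderiv_X_of_ne (show (3 : Fin 4) ≠ 1 by decide), Nat.reduceSub, pow_one, mul_one, mul_zero,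
    zero_mul, add_zero, zero_add, Nat.cast_ofNat]

/-- **`∂f₄/∂X₂ = 2X₂`** over any commutative ring (`pderiv_mul`, `pderiv_pow`, `pderiv_X_self`,
`pderiv_X_of_ne`). [folklore] -/
theorem pderiv_two_f4 {A : Type*} [CommRing A] :
    pderiv 2 (X 2 ^ 2 + X 0 ^ 3 + X 1 ^ 6 + X 3 ^ 3 * X 0 ^ 2 : MvPolynomial (Fin 4) A) =
      2 * X 2 := by
  simp only [map_add, pderiv_mul, pderiv_pow, pderiv_X_self,
    pderiv_X_of_ne (show (0 : Fin 4) ≠ 2 by decide), pderiv_X_of_ne (show (1 : Fin 4) ≠ 2 by decide),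
    pderiv_X_of_ne (show (3 : Fin 4) ≠ 2 by decide), Nat.reduceSub, pow_one, mul_one, mul_zero,
    zero_mul, add_zero, Nat.cast_ofNat]

/-- **`∂f₄/∂X₃ = 3X₃²X₀²`** over any commutative ring (`pderiv_mul`, `pderiv_pow`, `pderiv_X_self`,
`pderiv_X_of_ne`). [folklore] -/
theorem pderiv_three_f4 {A : Type*} [CommRing A] :
    pderiv 3 (X 2 ^ 2 + X 0 ^ 3 + X 1 ^ 6 + X 3 ^ 3 * X 0 ^ 2 : MvPolynomial (Fin 4) A) =
      3 * (X 3 ^ 2 * X 0 ^ 2) := by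
  simp only [map_add, pderiv_mul, pderiv_pow, pderiv_X_self,
    pderiv_X_of_ne (show (0 : Fin 4) ≠ 3 by decide), pderiv_X_of_ne (show (1 : Fin 4) ≠ 3 by decide),
    pderiv_X_of_ne (show (2 : Fin 4) ≠ 3 by decide), Nat.reduceSub, pow_one, mul_one, mul_zero,
    add_zero, zero_add, Nat.cast_ofNat]
  ring

/-! ## The fourth power of `f₄` modulo `(X₀⁵, X₁⁵, X₂⁵)` -/

/-- **`f₄⁴ ≡ 6·x₀⁴x₂⁴x₃⁶` modulo every ideal containing `x₀⁵, x₁⁵, x₂⁵`**, in any commutative ring: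
with `G = x₀³ + x₁⁶ + x₃³x₀²`, `(x₂² + G)⁴ - 6x₀⁴x₂⁴x₃⁶ = x₂⁵(x₂³ + 4x₂G) + 6x₂⁴(G² - x₀⁴x₃⁶) +
(4x₂² + G)G³`, and `G² - x₀⁴x₃⁶`, `G³` are explicit combinations of `x₀⁵` and `x₁⁵` (in
`G = x₀²(x₀ + x₃³) + x₁⁶` the square of the first summand is `x₀⁴x₃⁶` up to multiples of `x₀⁵`, and
every other product of two or three summands is a multiple of `x₀⁵` or `x₁⁵`). [folklore] -/
theorem f4_pow_four_sub_mem {A : Type*} [CommRing A] (x₀ x₁ x₂ x₃ : A) (J : Ideal A)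
    (h0 : x₀ ^ 5 ∈ J) (h1 : x₁ ^ 5 ∈ J) (h2 : x₂ ^ 5 ∈ J) :
    (x₂ ^ 2 + x₀ ^ 3 + x₁ ^ 6 + x₃ ^ 3 * x₀ ^ 2) ^ 4 - 6 * (x₀ ^ 4 * x₂ ^ 4 * x₃ ^ 6) ∈ J := by
  obtain ⟨G, hG⟩ : ∃ G : A, G = x₀ ^ 3 + x₁ ^ 6 + x₃ ^ 3 * x₀ ^ 2 := ⟨_, rfl⟩
  have hF : x₂ ^ 2 + x₀ ^ 3 + x₁ ^ 6 + x₃ ^ 3 * x₀ ^ 2 = x₂ ^ 2 + G := by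
    rw [hG]; ring
  have hF4 : (x₂ ^ 2 + G) ^ 4 - 6 * (x₀ ^ 4 * x₂ ^ 4 * x₃ ^ 6) =
      x₂ ^ 5 * (x₂ ^ 3 + 4 * x₂ * G) + 6 * x₂ ^ 4 * (G ^ 2 - x₀ ^ 4 * x₃ ^ 6) +
        (4 * x₂ ^ 2 + G) * G ^ 3 := by
    ring
  have hG2 : G ^ 2 - x₀ ^ 4 * x₃ ^ 6 =
      x₀ ^ 5 * (x₀ + 2 * x₃ ^ 3) + x₁ ^ 5 * (2 * x₀ ^ 2 * (x₀ + x₃ ^ 3) * x₁ + x₁ ^ 7) := by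
    rw [hG]; ring
  have hG3 : G ^ 3 = x₀ ^ 5 * (x₀ * (x₀ + x₃ ^ 3) ^ 3) +
      x₁ ^ 5 * (3 * x₀ ^ 4 * (x₀ + x₃ ^ 3) ^ 2 * x₁ + 3 * x₀ ^ 2 * (x₀ + x₃ ^ 3) * x₁ ^ 7 +
        x₁ ^ 13) := by
    rw [hG]; ring
  rw [hF, hF4, hG2, hG3]
  refine J.add_mem (J.add_mem (J.mul_mem_right _ h2)
    (J.mul_mem_left _ (J.add_mem (J.mul_mem_right _ h0) (J.mul_mem_right _ h1))))
    (J.mul_mem_left _ (J.add_mem (J.mul_mem_right _ h0) (J.mul_mem_right _ h1)))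

/-! ## The Fedder witness off the origin -/

/-- **The Fedder witness along the `X₃`-axis, off the origin.** For a field `k`, a non-unit
`c ∈ k[T]` with `T ∤ c`, the monomial `X₀⁴X₂⁴X₃⁶` does not lie in `(X₀⁵, X₁⁵, X₂⁵, c(X₃)⁵)`:
the `X₀⁴X₂⁴`-extraction `E : k[X] →+ k[T]` (`FedderAlongCoordinateLine.exists_extraction`, exponent
vector `(4,0,4,0)`, line `ℓ = 3`) is `k[T]`-linear, kills the multiples of `X₀⁵, X₁⁵, X₂⁵`, so maps
the ideal into `(c⁵)`, and sends `X₀⁴X₂⁴X₃⁶` to `T⁶`; but `c ∣ T⁶` with `c` coprime to the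
irreducible `T` makes `c` a unit. [folklore] -/
theorem monomial_notMem_span_pow {k : Type} [Field k] (c : Polynomial k) (hcu : ¬IsUnit c)
    (hXc : ¬(Polynomial.X : Polynomial k) ∣ c) :
    (X 0 ^ 4 * X 2 ^ 4 * X 3 ^ 6 : MvPolynomial (Fin 4) k) ∉
      Ideal.span (Set.range fun j : Fin 4 =>
        (if j = (3 : Fin 4) then Polynomial.aeval (X 3 : MvPolynomial (Fin 4) k) c else X j) ^ 5) := by
  classical
  intro hmem
  obtain ⟨a, ha_def⟩ : ∃ a : Fin 4 →₀ ℕ, a = Finsupp.single 0 4 + Finsupp.single 2 4 := ⟨_, rfl⟩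
  obtain ⟨E, hE⟩ := FedderAlongCoordinateLine.exists_extraction (k := k) (3 : Fin 4) a
  have ha : a 3 = 0 := by
    rw [ha_def, Finsupp.add_apply, Finsupp.single_eq_of_ne (by decide),
      Finsupp.single_eq_of_ne (by decide), add_zero]
  have hap : ∀ j : Fin 4, a j < 5 := by
    intro j
    rw [ha_def, Finsupp.add_apply, Finsupp.single_apply, Finsupp.single_apply]
    split_ifs <;> omega
  -- `E (X₀⁴X₂⁴) = 1`
  have hmon : (X 0 ^ 4 * X 2 ^ 4 : MvPolynomial (Fin 4) k) = monomial a 1 := by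
    rw [X_pow_eq_monomial, X_pow_eq_monomial, monomial_mul, one_mul, ha_def]
  have hE1 : E (X 0 ^ 4 * X 2 ^ 4) = 1 := by
    ext t
    rw [hE, hmon, coeff_monomial, Polynomial.coeff_one]
    by_cases ht : t = 0
    · rw [if_pos ht, if_pos (by rw [ht, Finsupp.single_zero, add_zero])]
    · rw [if_neg ht, if_neg]
      intro h
      have h3 := DFunLike.congr_fun h 3
      rw [Finsupp.add_apply, ha, Finsupp.single_eq_same, zero_add] at h3
      exact ht h3.symm
  -- `E (X₀⁴X₂⁴X₃⁶) = T⁶`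
  have hEM : E (X 0 ^ 4 * X 2 ^ 4 * X 3 ^ 6) = Polynomial.X ^ 6 := by
    have h := FedderAlongCoordinateLine.extraction_mul_aeval hE ha
      (Polynomial.aeval (X 3 : MvPolynomial (Fin 4) k)) rfl (X 0 ^ 4 * X 2 ^ 4) (Polynomial.X ^ 6)
    rw [map_pow, Polynomial.aeval_X, hE1, one_mul] at h
    exact h
  -- `E` maps the ideal into `(c⁵)`
  obtain ⟨h, hh⟩ := Ideal.mem_span_range_iff_exists_fun.mp hmem
  have hEf : E (X 0 ^ 4 * X 2 ^ 4 * X 3 ^ 6) = E (h 3) * c ^ 5 := by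
    rw [← hh, map_sum, Finset.sum_eq_single (3 : Fin 4)]
    · rw [if_pos rfl, ← map_pow, FedderAlongCoordinateLine.extraction_mul_aeval hE ha _ rfl]
    · intro j _ hj
      rw [if_neg hj, FedderAlongCoordinateLine.extraction_mul_X_pow hE hj (hap j)]
    · intro h3
      exact absurd (Finset.mem_univ _) h3
  -- `c ∣ T⁶`, `c` coprime to `T`: `c` is a unit
  have hdvd5 : c ^ 5 ∣ (Polynomial.X : Polynomial k) ^ 6 := ⟨E (h 3), by rw [← hEM, hEf, mul_comm]⟩
  have hdvd : c ∣ (Polynomial.X : Polynomial k) ^ 6 :=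
    (dvd_pow_self c (by norm_num : (5 : ℕ) ≠ 0)).trans hdvd5
  have hcop : IsCoprime (Polynomial.X : Polynomial k) c :=
    (Polynomial.irreducible_X.coprime_iff_not_dvd).mpr hXc
  exact hcu (hcop.pow_left.isUnit_of_dvd' hdvd (dvd_refl c))

/-! ## Registered form -/

/-- **THE SPECIMEN IS INTEGRAL WITH ONE BAD POINT** (stub `stub_f4Isolated` of line `Sketch`):
`f₄ = X₂² + X₀³ + X₁⁶ + X₃³X₀²` over any field `k` of characteristic `5`: `(f₄)` is prime
(`prime_f4`: `T² + c` with `-c` a non-square), and at every maximal ideal `Q` of `k[X]/(f₄)` other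
than the origin (some `x̄ⱼ ∉ Q`) the local ring `(k[X]/(f₄))_Q` satisfies the per-stalk clause of
`FrobeniusLadder.FInjectiveMacaulayfication` — every system of parameters is weakly regular and
generates a Frobenius closed ideal. Off the singular locus (some `∂ⱼf₄ ∉ Q ∩ k[X]`) this is the
Jacobian discharger `ClauseOfPderivNotMem.stub_clauseOfPderivNotMem`; if all partials
`∂₂ = 2X₂`, `∂₁ = 6X₁⁵`, `∂₀ = 3X₀² + 2X₃³X₀`, `∂₃ = 3X₃²X₀²` lie in `P = Q ∩ k[X]` then
`X₀, X₁, X₂ ∈ P`, so `X₃ ∉ P`, `P = (X₀, X₁, X₂, c(X₃))` with `c` a non-unit, `T ∤ c`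
(`FedderAlongCoordinateLine.exists_eq_span_of_X_mem`), and Fedder's test
`f₄⁴ ∉ (X₀⁵, X₁⁵, X₂⁵, c(X₃)⁵)` holds since `f₄⁴ ≡ 6·X₀⁴X₂⁴X₃⁶ mod (X₀⁵, X₁⁵, X₂⁵)`
(`f4_pow_four_sub_mem`) with `6` a unit in characteristic `5` (`monomial_notMem_span_pow`); conclude
by `FedderAtMaximalIdeal.stub_fedderAtMaximalIdeal`. [cite: Fedder1983, Prop. 1.7 and Thm. 1.12] -/
theorem stub_f4Isolated : ∀ (k : Type) [Field k] [CharP k 5] (f : MvPolynomial (Fin 4) k),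
    f = MvPolynomial.X 2 ^ 2 + MvPolynomial.X 0 ^ 3 + MvPolynomial.X 1 ^ 6 + MvPolynomial.X 3 ^ 3 * MvPolynomial.X 0 ^ 2 →
    (Ideal.span {f}).IsPrime ∧
    ∀ (Q : Ideal (MvPolynomial (Fin 4) k ⧸ Ideal.span {f})) [Q.IsMaximal],
      (∃ j : Fin 4, Ideal.Quotient.mk (Ideal.span {f}) (MvPolynomial.X j) ∉ Q) →
      ∀ d : ℕ, ringKrullDim (Localization.AtPrime Q) = d → ∀ s : Fin d → Localization.AtPrime Q,
        (Ideal.span (Set.range s)).radical.IsMaximal →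
          RingTheory.Sequence.IsWeaklyRegular (Localization.AtPrime Q) (List.ofFn s) ∧
          ∀ y : Localization.AtPrime Q, (∃ e : ℕ, y ^ 5 ^ e ∈ Ideal.span
            ((fun z : Localization.AtPrime Q => z ^ 5 ^ e) ''
              (Ideal.span (Set.range s) : Set (Localization.AtPrime Q)))) → y ∈ Ideal.span (Set.range s) := by
  intro k _ _ f hf
  haveI : Fact (Nat.Prime 5) := ⟨Nat.prime_five⟩
  have hprime : Prime f := prime_f4 k f hf
  refine ⟨(Ideal.span_singleton_prime hprime.ne_zero).mpr hprime, ?_⟩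
  intro Q _ hQ d hd s hs
  -- `P₀ = Q ∩ k[X]`, a maximal ideal of `k[X]`
  haveI hP₀max : (Q.comap (Ideal.Quotient.mk (Ideal.span {f}))).IsMaximal :=
    Ideal.comap_isMaximal_of_surjective _ Ideal.Quotient.mk_surjective
  have hP₀ := hP₀max.isPrime
  -- arithmetic of characteristic `5` in `k[X]`
  have h5 : (5 : MvPolynomial (Fin 4) k) = 0 := by
    exact_mod_cast CharP.cast_eq_zero (MvPolynomial (Fin 4) k) 5
  have hu2 : IsUnit (2 : MvPolynomial (Fin 4) k) :=
    IsUnit.of_mul_eq_one 3 (by linear_combination h5)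
  have hu3 : IsUnit (3 : MvPolynomial (Fin 4) k) :=
    IsUnit.of_mul_eq_one 2 (by linear_combination h5)
  have hu6 : IsUnit (6 : MvPolynomial (Fin 4) k) :=
    IsUnit.of_mul_eq_one 1 (by linear_combination h5)
  -- the partial derivatives
  have hd0 : pderiv 0 f = 3 * X 0 ^ 2 + 2 * (X 3 ^ 3 * X 0) := by rw [hf, pderiv_zero_f4]
  have hd1 : pderiv 1 f = 6 * X 1 ^ 5 := by rw [hf, pderiv_one_f4]
  have hd2 : pderiv 2 f = 2 * X 2 := by rw [hf, pderiv_two_f4]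
  have hd3 : pderiv 3 f = 3 * (X 3 ^ 2 * X 0 ^ 2) := by rw [hf, pderiv_three_f4]
  -- off the singular locus: the Jacobian discharger in direction `j`
  by_cases hm2 : pderiv 2 f ∈ Q.comap (Ideal.Quotient.mk (Ideal.span {f})); swap
  · exact ClauseOfPderivNotMem.stub_clauseOfPderivNotMem 5 k 4 f Q 2 hm2 d hd s hs
  by_cases hm1 : pderiv 1 f ∈ Q.comap (Ideal.Quotient.mk (Ideal.span {f})); swap
  · exact ClauseOfPderivNotMem.stub_clauseOfPderivNotMem 5 k 4 f Q 1 hm1 d hd s hs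
  by_cases hm0 : pderiv 0 f ∈ Q.comap (Ideal.Quotient.mk (Ideal.span {f})); swap
  · exact ClauseOfPderivNotMem.stub_clauseOfPderivNotMem 5 k 4 f Q 0 hm0 d hd s hs
  by_cases hm3 : pderiv 3 f ∈ Q.comap (Ideal.Quotient.mk (Ideal.span {f})); swap
  · exact ClauseOfPderivNotMem.stub_clauseOfPderivNotMem 5 k 4 f Q 3 hm3 d hd s hs
  -- all partials vanish at `Q`: `X₀, X₁, X₂ ∈ P₀`, hence `X₃ ∉ P₀`
  have hX2 : (X 2 : MvPolynomial (Fin 4) k) ∈ Q.comap (Ideal.Quotient.mk (Ideal.span {f})) := by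
    rw [hd2] at hm2
    exact (Ideal.unit_mul_mem_iff_mem _ hu2).mp hm2
  have hX1 : (X 1 : MvPolynomial (Fin 4) k) ∈ Q.comap (Ideal.Quotient.mk (Ideal.span {f})) := by
    rw [hd1] at hm1
    exact hP₀.mem_of_pow_mem 5 ((Ideal.unit_mul_mem_iff_mem _ hu6).mp hm1)
  have hX0 : (X 0 : MvPolynomial (Fin 4) k) ∈ Q.comap (Ideal.Quotient.mk (Ideal.span {f})) := by
    rw [hd3] at hm3
    have h30 := (Ideal.unit_mul_mem_iff_mem _ hu3).mp hm3
    rcases hP₀.mem_or_mem h30 with h3 | h0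
    · -- `X₃ ∈ P₀`: `3X₀² = ∂₀f - 2X₃³X₀ ∈ P₀`
      have hX3 : (X 3 : MvPolynomial (Fin 4) k) ∈ Q.comap (Ideal.Quotient.mk (Ideal.span {f})) :=
        hP₀.mem_of_pow_mem 2 h3
      have e : (3 * X 0 ^ 2 : MvPolynomial (Fin 4) k) = pderiv 0 f - 2 * (X 3 ^ 2 * X 0) * X 3 := by
        rw [hd0]; ring
      refine hP₀.mem_of_pow_mem 2 ((Ideal.unit_mul_mem_iff_mem _ hu3).mp ?_)
      rw [e]
      exact Ideal.sub_mem _ hm0 (Ideal.mul_mem_left _ _ hX3)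
    · exact hP₀.mem_of_pow_mem 2 h0
  have hX3 : (X 3 : MvPolynomial (Fin 4) k) ∉ Q.comap (Ideal.Quotient.mk (Ideal.span {f})) := by
    obtain ⟨j, hj⟩ := hQ
    intro hX3
    apply hj
    rw [← Ideal.mem_comap]
    fin_cases j
    exacts [hX0, hX1, hX2, hX3]
  have hXP : ∀ j : Fin 4, j ≠ 3 →
      (X j : MvPolynomial (Fin 4) k) ∈ Q.comap (Ideal.Quotient.mk (Ideal.span {f})) := by
    intro j hj
    fin_cases j
    · exact hX0
    · exact hX1
    · exact hX2
    · exact absurd rfl hj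
  -- `P₀ = (X₀, X₁, X₂, c(X₃))` for a non-unit `c ∈ k[T]` with `T ∤ c`
  obtain ⟨c, hcu, hP⟩ := FedderAlongCoordinateLine.exists_eq_span_of_X_mem k 4 (3 : Fin 4)
    (Polynomial.aeval (X 3 : MvPolynomial (Fin 4) k)) rfl
    (Q.comap (Ideal.Quotient.mk (Ideal.span {f}))) hXP
  have hXc : ¬(Polynomial.X : Polynomial k) ∣ c := by
    rintro ⟨c', rfl⟩
    apply hX3
    -- `P₀ ≤ (X₀, …, X₃) ≠ ⊤`, so `P₀ = (X)` contains `X₃`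
    have hle : Q.comap (Ideal.Quotient.mk (Ideal.span {f})) ≤
        Ideal.span (Set.range (X : Fin 4 → MvPolynomial (Fin 4) k)) := by
      rw [hP, Ideal.span_le]
      rintro _ ⟨j, rfl⟩
      by_cases hj : j = 3
      · show (if j = 3 then Polynomial.aeval (X 3 : MvPolynomial (Fin 4) k) (Polynomial.X * c')
          else X j) ∈ Ideal.span (Set.range (X : Fin 4 → MvPolynomial (Fin 4) k))
        rw [if_pos hj, map_mul, Polynomial.aeval_X]
        exact Ideal.mul_mem_right _ _ (Ideal.subset_span ⟨3, rfl⟩)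
      · show (if j = 3 then Polynomial.aeval (X 3 : MvPolynomial (Fin 4) k) (Polynomial.X * c')
          else X j) ∈ Ideal.span (Set.range (X : Fin 4 → MvPolynomial (Fin 4) k))
        rw [if_neg hj]
        exact Ideal.subset_span ⟨j, rfl⟩
    have hne : Ideal.span (Set.range (X : Fin 4 → MvPolynomial (Fin 4) k)) ≠ ⊤ :=
      (Fedder.isMaximal_span_range_X k 4).ne_top
    rw [hP₀max.eq_of_le hne hle]
    exact Ideal.subset_span ⟨3, rfl⟩
  -- Fedder's test at `P₀`: `f⁴ ≡ 6·X₀⁴X₂⁴X₃⁶ mod (X₀⁵, X₁⁵, X₂⁵)`, `6` a unit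
  have hfed : f ^ (5 - 1) ∉ Ideal.span (Set.range fun i : Fin 4 =>
      (if i = (3 : Fin 4) then Polynomial.aeval (X 3 : MvPolynomial (Fin 4) k) c else X i) ^ 5) := by
    intro hmem
    apply monomial_notMem_span_pow c hcu hXc
    have hXJ : ∀ j : Fin 4, j ≠ 3 → (X j : MvPolynomial (Fin 4) k) ^ 5 ∈
        Ideal.span (Set.range fun i : Fin 4 =>
          (if i = (3 : Fin 4) then Polynomial.aeval (X 3 : MvPolynomial (Fin 4) k) c else X i) ^ 5) :=
      fun j hj => Ideal.subset_span ⟨j, by simp only [if_neg hj]⟩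
    rw [hf, show (5 - 1 : ℕ) = 4 from rfl] at hmem
    have h6 := Ideal.sub_mem _ hmem (f4_pow_four_sub_mem (X 0) (X 1) (X 2) (X 3) _
      (hXJ 0 (by decide)) (hXJ 1 (by decide)) (hXJ 2 (by decide)))
    rw [sub_sub_cancel] at h6
    exact (Ideal.unit_mul_mem_iff_mem _ hu6).mp h6
  exact FedderAtMaximalIdeal.stub_fedderAtMaximalIdeal 5 k 4 4
    (fun j : Fin 4 => if j = (3 : Fin 4) then Polynomial.aeval (X 3 : MvPolynomial (Fin 4) k) c
      else X j) f Q hP hprime.ne_zero hfed d hd s hs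

end Summit.ResolutionOfSingularities.ResolutionOfSingularities.Theorems.FInjectiveMacaulayfication.F4Isolated

end
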